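import Summits.ValiantsHypothesis.ValiantsHypothesis.Theses.MonotoneRestoration
import Summits.ValiantsHypothesis.ValiantsHypothesis.Theorems.MonotoneRestorationMonotoneRestorationQPBeta
import Summits.ValiantsHypothesis.ValiantsHypothesis.Theorems.MonotoneRestorationMonotoneRestorationQPSparseRegime

/-!
# `MonotoneRestoration.MonotoneRestorationQP` (stmt-ValiantsHypothesis-15886) — negative side: the two cheapest non-witnesses

Refuter crux-attack pass (basic attacks). Two small facts that close the two cheapest refutation
attempts against the crux
`Summit.ValiantsHypothesis.ValiantsHypothesis.Theses.MonotoneRestoration.MonotoneRestorationQP`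
(quasi-polynomial square-symmetric circuits over `ℂ` for every matrix-symmetric family over
`ℝ≥0` of polynomial degree and polynomial MONOTONE complexity):

* `perPoly_not_polyMonotone` / `perPoly_not_hypothesis` — the nonnegative PERMANENT, the only
  family with a proved super-quasi-polynomial square-symmetric lower bound in the tree
  (Dawar–Wilsenach 2025 Thm 7.1, `not_qpSymmetric_perPoly`), is OUTSIDE the hypothesis class: by
  the tree's Jerrum–Snir bound `two_pow_le_complexity_perPoly`
  (`2^n ≤ 64 (L⁺(per_n)+1)^3 (n+1)^6`) its monotone complexity is not `≤ (n+2)^c` for any `c`.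
  So the Dawar–Wilsenach witness does not bite the crux as stated (it bites only the variant
  without the complexity clause, `monotoneRestorationQP_false_without_complexity`).
* `conclusion_of_eventually_zero` — FINITE TRUNCATIONS ARE VACUOUS: every matrix-symmetric family
  that vanishes from some order on satisfies the CONCLUSION of the crux (the finitely many live
  orders have bounded degree, hence fall in the proved polylog-degree regime
  `monotoneRestorationQP_of_polylogDegree`, the exponent absorbing them). Consequently no finite
  computation / bounded counterexample search can refute the crux: a refutation needs one family
  with a super-quasi-polynomial symmetric lower bound at infinitely many orders (the filed kill
  witness `PolylogWidthMonotoneEasy`).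

No facts, no definitions. [folklore]
-/

set_option linter.dupNamespace false

namespace Summit.ValiantsHypothesis.ValiantsHypothesis.Theorems.MonotoneRestorationQP.Negative

open Literature.Computability.AlgebraicComplexity MvPolynomial

noncomputable section

/-- **The permanent is not monotone-polynomial** in the tree's `complexity` model over the
semiring `ℝ≥0`: there is no `c` with `L⁺(per_n) ≤ (n+2)^c` for all `n` (from the tree's
Jerrum–Snir form `two_pow_le_complexity_perPoly` and `m^d < 2^m` eventually).
[cite: JerrumSnir1982, §4.3] -/
theorem perPoly_not_polyMonotone :
    ¬ ∃ c : ℕ, ∀ n : ℕ, complexity (k := NNReal) (perPoly (Fin n) NNReal) ≤ (n + 2) ^ c := by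
  rintro ⟨c, hc⟩
  have hlim : Filter.Tendsto (fun m : ℕ => (m : ℝ) ^ (3 * c + 15) / (2 : ℝ) ^ m)
      Filter.atTop (nhds 0) :=
    tendsto_pow_const_div_const_pow_of_one_lt (3 * c + 15) one_lt_two
  obtain ⟨m₀, hm₀⟩ :=
    Filter.eventually_atTop.1 (hlim.eventually (gt_mem_nhds (by norm_num : (0 : ℝ) < 1 / 4)))
  set n : ℕ := m₀ with hn
  have key := Summit.ValiantsHypothesis.ValiantsHypothesis.Theorems.two_pow_le_complexity_perPoly n
  have h1 : 64 * (complexity (perPoly (Fin n) NNReal) + 1) ^ 3 * (n + 1) ^ 6 ≤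
      (n + 2) ^ (3 * c + 15) := by
    have hL := hc n
    have h2n : 2 ≤ n + 2 := by omega
    calc 64 * (complexity (perPoly (Fin n) NNReal) + 1) ^ 3 * (n + 1) ^ 6
        ≤ 64 * ((n + 2) ^ c + 1) ^ 3 * (n + 2) ^ 6 := by gcongr; omega
      _ ≤ (n + 2) ^ 6 * ((n + 2) ^ (c + 1)) ^ 3 * (n + 2) ^ 6 := by
          gcongr
          · calc (64 : ℕ) = 2 ^ 6 := by norm_num
              _ ≤ (n + 2) ^ 6 := Nat.pow_le_pow_left h2n 6
          · calc (n + 2) ^ c + 1 ≤ (n + 2) ^ c + (n + 2) ^ c :=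
                  Nat.add_le_add_left (Nat.one_le_pow _ _ (by omega)) _
              _ = 2 * (n + 2) ^ c := by ring
              _ ≤ (n + 2) * (n + 2) ^ c := Nat.mul_le_mul_right _ h2n
              _ = (n + 2) ^ (c + 1) := by ring
      _ = (n + 2) ^ (3 * c + 15) := by ring
  have h3 : (2 : ℕ) ^ n ≤ (n + 2) ^ (3 * c + 15) := key.trans h1
  have h3' : ((2 : ℝ)) ^ n ≤ ((n : ℝ) + 2) ^ (3 * c + 15) := by exact_mod_cast h3
  have h4 := hm₀ (n + 2) (by omega)
  rw [div_lt_iff₀ (by positivity)] at h4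
  push_cast at h4
  have h5 : (1 : ℝ) / 4 * (2 : ℝ) ^ (n + 2) = 2 ^ n := by ring
  linarith

/-- **The permanent violates hypothesis 2 of the crux, verbatim** (polynomial degree AND
polynomial monotone complexity): the degree clause holds (`deg per_n = n`) but the complexity
clause fails (`perPoly_not_polyMonotone`). [cite: JerrumSnir1982, §4.3] -/
theorem perPoly_not_hypothesis :
    ¬ ∃ c : ℕ, ∀ n : ℕ, (perPoly (Fin n) NNReal).totalDegree ≤ (n + 2) ^ c ∧
      complexity (k := NNReal) (perPoly (Fin n) NNReal) ≤ (n + 2) ^ c :=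
  fun ⟨c, hc⟩ => perPoly_not_polyMonotone ⟨c, fun n => (hc n).2⟩

/-- **Finite truncations of the crux are vacuous**: a matrix-symmetric family over `ℝ≥0` that is
zero from some order `N` on satisfies the conclusion of `MonotoneRestorationQP` — the live orders
`n < N` have degree at most `D := max_{n<N} deg (f n) ≤ (log₂ n + D + 1)^(D+1)`, so the proved
polylog-degree regime `monotoneRestorationQP_of_polylogDegree` applies. Hence no bounded
counterexample search bites the crux. [folklore] -/
theorem conclusion_of_eventually_zero (f : (n : ℕ) → MvPolynomial (Fin n × Fin n) NNReal)
    (hf : ∀ (n : ℕ) (σ τ : Equiv.Perm (Fin n)),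
      MvPolynomial.rename (fun p : Fin n × Fin n => (σ p.1, τ p.2)) (f n) = f n)
    (N : ℕ) (hN : ∀ n, N ≤ n → f n = 0) :
    ∃ c : ℕ, ∀ n : ℕ, ∃ (G : Type) (_ : Fintype G)
      (C : LabelledArithCircuit ℂ (Fin n × Fin n) Unit G),
      C.IsSymmetric (Equiv.Perm (Fin n)) ∧
      C.eval (C.output ()) = MvPolynomial.map (Complex.ofRealHom.comp NNReal.toRealHom) (f n) ∧
      Fintype.card G ≤ 2 ^ ((Nat.log 2 n + c) ^ c) := by
  classical
  let D : ℕ := (Finset.range N).sup fun n => (f n).totalDegree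
  refine Summit.ValiantsHypothesis.ValiantsHypothesis.Theorems.monotoneRestorationQP_of_polylogDegree
    f hf ⟨D + 1, fun n => ?_⟩
  rcases Nat.lt_or_ge n N with h | h
  · have hD : (f n).totalDegree ≤ D :=
      Finset.le_sup (f := fun n => (f n).totalDegree) (Finset.mem_range.2 h)
    calc (f n).totalDegree ≤ D := hD
      _ ≤ D + 1 := Nat.le_succ _
      _ ≤ Nat.log 2 n + (D + 1) := Nat.le_add_left _ _
      _ ≤ (Nat.log 2 n + (D + 1)) ^ (D + 1) := Nat.le_self_pow (by omega) _
  · rw [hN n h]; simp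

end

end Summit.ValiantsHypothesis.ValiantsHypothesis.Theorems.MonotoneRestorationQP.Negative
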